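import Literature.AlgebraicGeometry.HodgeTheory.ComplexTorusIntegralHodgeClassesKunnethProjectorsPolarizationType
import Literature.AlgebraicGeometry.HodgeTheory.ComplexTorusIntegralHodgeClassesCorrespondenceActionBridge
import Literature.AlgebraicGeometry.HodgeTheory.ComplexTorusIntegralHodgeClassesLefschetzCorrespondenceCentralizer
import Literature.Geometry.Kaehler.ComplexTorusLefschetzDualCorrespondence
import Literature.Geometry.Kaehler.ComplexTorusLefschetzAlgebraCorrespondencesAnyBasis
import HarnessLib

/-!
# Künnemann's integral `Λ`-correspondence `Π_{c₁(L)^{[g−1]}}` induces `(d₁⋯d_g) · Λ_{c₁(L)}` on `H•(X, ℂ)`: the integral series meets Layer A's `B(X)`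

Layer `Literature/AlgebraicGeometry/HodgeTheory`, namespace `Literature.AlgebraicGeometry.HodgeTheory.ComplexTorusCat`; lane `lit-hodgefound` (Track 2
foundations library, Layer A1/A4), prover seat `lit-hodgefound-p35` (gen 35, row g35-#2). The seat's series g33-#7 … g34-#8 built, on the INTEGRAL Hodge
classes `Hdg•(X × X, ℤ)` of a polarized complex torus `(X, θ)` of type `(d₁, …, d_g)` (`Θ = −θ = c₁(L)`, `D = d₁⋯d_g`), Künnemann's Lefschetz triple: `L =
Δ_*[Θ] ∈ Hdg^{g+1}`, the Pontryagin correspondence `Π_{Θ^{[g−1]}} = (s_X)_*(p₂^*Θ^{[g−1]}) ∈ Hdg^{g−1}` (`s_X = (pr₁, pr₁ + pr₂)`; `= δ^*Θ^{[g−1]}` for `δ = pr₁ − pr₂`,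
g34-#2) and `H_X = Σ (s − g) π_s`, with `[Δ_*[Θ], Π_{Θ^{[g−1]}}] = D · H_X` (g34-#8) — and g35-#1 proved that `Π_{Θ^{[g−1]}}` is the UNIQUE integral correspondence of
degree `−1` with this commutator. Layer A (rows A4-54/A4-55/Q472⁺ of p06/p08: `Geometry/Kaehler/ComplexTorusLefschetzDual*`) carries Hodge theory's dual
Lefschetz OPERATOR `Λ_ω = lefschetzDual (−η) m : H^{m+2}(X, ℂ) → Hᵐ(X, ℂ)` for the Kähler class `ω = c₁(L) = −E` (Voisin's Lemma 6.19 / Huybrechts'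
Prop. 1.2.26) and Milne's Theorem 5.9 / Kleiman's `B(X)` at torus level: **`Λ_ω = (δ^* c_L)^*`** with `c_L = c₁(L)^{∧(g−1)}/(D (g−1)!)`
(`IsSymplecticEnum.corrMapT_pullbackForms_curveClass_eq_lefschetzDual_neg`, for a symplectically presented lattice). THIS FILE JOINS THE TWO:

* §1 **`corrMapT_pullbackForms_curveClass_eq_lefschetzDual_neg_of_isPolarizationType`** — Layer A's `(δ^* c_L)^* = Λ_ω` for EVERY presentation of the
  polarized torus (hypotheses `IsPolarizationType Φ η d`, `IsRiemannForm Φ η` only; no symplectic lattice basis): `corrMapT` depends only on the lattice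
  (Layer A `corrMapT_eq_of_range_latticeVec_eq`), the form `δ^* c_L = c_L ∘ (pr₁ − pr₂)` is presentation-free, and every polarized lattice has a symplectic
  re-presentation (`IsPolarizationType.exists_isSymplecticEnum`) — the transport p08/p06 used for `Λ = −ε c_L ⋆ ·` (`…AnyBasis`), run for the correspondence form;
* §2 **`coe_pontryaginCorrespondence_nsDivPower_neg_eq_smul_pullbackForms_curveClass`** — AS A FORM ON `E × E`, KÜNNEMANN'S INTEGRAL CLASS IS `D` TIMES MILNE'S
  RATIONAL LEFSCHETZ CLASS: `Π_{Θ^{[g−1]}} = D · δ^* c_L` (`Π_c = (pr₁ − pr₂)^*c`, g34-#2; `Θ^{[n]} = (n!)⁻¹ Θ^{∧n}` and `c_L = (D (g−1)!)⁻¹ c₁(L)^{∧(g−1)}` with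
  `c₁(L) = Θ = −θ`);
* §3 **`coe_integralHodgeClassesPushforward_fstHom_pontryaginCorrespondence_nsDivPower_cup_pullbackHom_sndHom_eq_smul_lefschetzDual`** — THE HEADLINE: for every
  integral Hodge class `y ∈ Hdgᵖ(X, ℤ)` the class `(Π_{Θ^{[g−1]}})^*(y) = p_{1*}(Π_{Θ^{[g−1]}} · p₂^*y) ∈ Hdg^{p−1}(X, ℤ)` of the integral series (Fulton's Def. 16.1.2;
  `= y ⋆ Θ^{[g−1]}`, g34-#1 §2) IS, as a form, `(d₁⋯d_g) · Λ_{c₁(L)}(y)` — Künnemann's / Polishchuk's "`f = (d^{g−1}/((g−1)! χ(d))) ∗ ·`" meets Voisin's `Λ`: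
  g29-#2's bridge `α^* = corrMapT α` (`…CorrespondenceActionBridge`), §2, `ℂ`-linearity and degree bookkeeping of `corrMapT` (Layer A
  `corrMapT_smul`, `corrMapT_domDomCongr_finCongr`, `corrMapT_apply_domDomCongr`), and §1. With g35-#1: the unique degree-`−1` partner `Λ′` of
  `(Δ_*[c₁(L)], H_X)` in the integral correspondence algebra acts on `H•(X, ℂ)` as `(d₁⋯d_g) · Λ_{c₁(L)}` — the Lefschetz standard conjecture `B(X)` for
  abelian varieties with Künnemann's explicit cycle, integrally up to the exponent `d₁⋯d_g`, and for a principal polarization ON THE NOSE (`…_of_principal`);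
* §4 (g35-#3) **`coe_integralHodgeClassesPushforward_sndHom_pontryaginCorrespondence_nsDivPower_cup_pullbackHom_fstHom_eq_smul_lefschetzDual`**,
  **`coe_integralHodgeClassesPontryagin_nsDivPower_neg_eq_smul_lefschetzDual`**, **`smul_lefschetzDual_neg_mem_integralHodgeClasses`** — the COVARIANT action
  `(Π)_*(x) = x ⋆ Θ^{[g−1]}` (the integral Pontryagin product, g31-#4) is the same `(d₁⋯d_g) · Λ_ω(x)` (`Π` is symmetric, g34-#1), and `(d₁⋯d_g) · Λ_ω` maps
  `Hdgᵖ(X, ℤ)` into `Hdg^{p−1}(X, ℤ)` (for a principal polarization `Λ_ω` itself does);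
* §5 (g35-#3) **`coe_integralHodgeClassesPushforward_sndHom_pushforward_diagHom_cup_pullbackHom_fstHom_eq_lefschetzPow`** (and the `fstHom/sndHom` twin) — the
  first member of the triple acts as Layer A's Lefschetz operator: `((Δ_*[Θ])_*(x) : form) = ((Δ_*[Θ])^*(x) : form) = lefschetzPow Θ 1 x = Θ ∧ x` (g33-#3);
* §6 (g35-#4) **`coe_integralHodgeClassesPushforward_fstHom_cup_pullbackHom_sndHom_eq_smul_lefschetzDual_of_sub_eq_zsmul_kunnethGrading`** (and the covariant
  twin, and the `D′ = 1` case `…_eq_lefschetzDual_of_sub_eq_kunnethGrading`) — UNIQUENESS READ IN LAYER A'S LANGUAGE: EVERY integral correspondence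
  `Λ′ ∈ Hdg^{g−1}(X × X, ℤ)` with `Δ_*[Θ] ∘ Λ′ − Λ′ ∘ Δ_*[Θ] = D′ · H_X` acts on every integral Hodge class as `D′ · Λ_ω` (g35-#1's Bourbaki Lemma 1
  `(d₁⋯d_g) · Λ′ = D′ · Π` in `…LefschetzCorrespondenceCentralizer`, §3/§4, and cancellation of `d₁⋯d_g ≠ 0` in the `ℂ`-space of forms) — Looijenga–Lunts'
  uniqueness of the `𝔰𝔩₂`-partner (Layer A `eq_lefschetzDualG_of_isSl2Triple`, which needs the whole triple on all forms) from the single relation `[L, Λ′] = D′H`.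

Theorems only (kernel path): NO definition, NO named fact, no `sorry` (D-0026); `Π_{Θ^{[g−1]}}`, `(Π)^*(y)` written out exactly as in g34-#1 §2 / g34-#8 §5.

## The sources, as printed

J. S. Milne, *Lefschetz classes on abelian varieties*, Duke Math. J. 96 (1999) (held `paper:doi-10-1215-s0012-7094-99-09620-5`), p0026 L74–L75: "**Theorem 5.9.**
Let `A` be an abelian variety over `Ω`. The correspondences `Λ`, `ᶜΛ`, and `*` between `A` and itself are all Lefschetz"; p0027 L5–L9: "It is known (e.g.,
Kleiman 1968, p367) that `Λ`, regarded as a map of cohomology groups, is inverse to `L` …". A. Polishchuk, *Fourier-stable subrings in the Chow rings of abelian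
varieties*, arXiv:0705.0772 §1 (p0003 L66–L69): "with such a polarization one can associate a Lefschetz `sl₂`-action on `CH*(A)_ℚ` as follows (see [K]):
`e(x) = d·x`, `f(x) = (d^{g-1}/((g-1)! χ(d))) ∗ x`, `h|_{CH^p_s(A)} = (2p-s-g) id`". B. Moonen, arXiv:1110.4264 §5 (p0015 L2–L5): "our class `λ(γ^{-1})` is
Künnemann's 'curve class' `c` and our `Λ_{γ^{-1}}` is his Lambda-operator `ᶜΛ = ᶜΛ_c`. In particular, [(KunLef)], Thm. 3.3, gives the commutation relation
`[Λ_{γ^{-1}}, L_γ] = Σ_{i=0}^{2g} (g − i)π_i = h_{id_X}`." J. Murre, in *Algebraic Cycles and Hodge Theory* (LNM 1594) 7.7 (p0122 L19–L25): "there is a unique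
cohomological operator `Λ` 'quasi-inverse' to the Lefschetz operator `L` … (LStC): The operator `Λ` is algebraic, i.e., is induced by an algebraic cycle on
`X × X`". C. Voisin, *Hodge Theory and Complex Algebraic Geometry I* §6.2.1 Lemma 6.19 (`[L, Λ] = (k − n) Id` on `k`-forms), §11.3.3 (11.11) (the action
`β̃` of a class on `X × Y`). H. Lange, *Abelian Varieties over the Complex Numbers* (2023) §6.3.2 (p0316 L14): "Define `c_L := L^{·(g-1)}/(d(g-1)!) ∈
Ch_1(X)_ℚ`"; §6.2.2 (p0303 L19–L37): "`Z(α) := p_{2*}(Z · p_1^*α)`", "`Z ↦ ᵗZ := s^*Z`".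

## References
* [Milne1999LefschetzClasses] J. S. Milne, Lefschetz classes on abelian varieties, Duke Math. J. 96 (1999) 639–675 — §5 Thm. 5.9 with proof (p0026 L74 – p0027 L9).
* [Polishchuk2007FourierStable] A. Polishchuk, Fourier-stable subrings in the Chow rings of abelian varieties, arXiv:0705.0772 — §1 (p0003 L66–L69, L126).
* [Moonen2011ChowMotiveAbelianSchemes] B. Moonen, On the Chow motive of an abelian scheme with non-trivial endomorphisms, arXiv:1110.4264 — §5 (p0015 L2–L5).
* [GreenMurreVoisin1994] M. Green, J. Murre, C. Voisin, Algebraic Cycles and Hodge Theory, LNM 1594 — Murre Ch. 7 §7.7 (p0122 L19–L25, p0123 L11).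
* [VoisinHodgeI2002] C. Voisin, Hodge Theory and Complex Algebraic Geometry I, CUP 2002 — §6.2.1 Lemma 6.19, §11.3.3 (11.11), Lemma 11.41.
* [Lange2023AbelianVarietiesComplex] H. Lange, Abelian Varieties over the Complex Numbers, Springer 2023 — §1.5.1 (p0051–p0052), §2.5.3 (p0133), §6.2.2 (p0303–p0304),
  §6.3.2 (p0316 L14), §6.3.4 (p0319 L28–L36).
* [Fulton1998] W. Fulton, Intersection Theory, 2nd ed., Springer 1998 — §16.1 Def. 16.1.2, Prop. 16.1.2 (b) (p0295 L9–L27).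
* [Kleiman1968AlgebraicCycles] S. L. Kleiman, Algebraic cycles and the Weil conjectures, in: Dix exposés sur la cohomologie des schémas (1968) — §2 (`B(X)`), p. 367.
* [Bourbaki2008LieGroups79] N. Bourbaki, Lie Groups and Lie Algebras, Chapters 7–9, Springer 2008 — Ch. VIII §11 no. 1 Lemma 1 (p0203 L3–L5).
* [LooijengaLunts1997] E. Looijenga, V. Lunts, A Lie algebra attached to a projective variety, Invent. Math. 129 (1997) 361–412 — §1 (1.1) (uniqueness of `f`).
* [CattaniElZeinGriffithsLe2014] E. Cattani, F. El Zein, P. Griffiths, Lê D. T. (eds.), Hodge Theory, Princeton 2014 — Ch. 1 §1.3 (the Lefschetz operators `L`, `Λ`, `H`).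
-/

noncomputable section

open CategoryTheory Function

namespace Literature.AlgebraicGeometry.HodgeTheory

open Literature.AlgebraicGeometry.Motives Literature.AlgebraicGeometry.Motives.HodgeStructure
open Literature.Geometry.Kaehler Literature.Geometry.Kaehler.ComplexTorus

/-! ## §1 Layer A's `(δ^* c_L)^* = Λ_ω` for every presentation of a polarized complex torus -/

section AnyBasis

variable {ι : Type*} [Fintype ι] [DecidableEq ι] {E : Type*} [NormedAddCommGroup E] [NormedSpace ℂ E] [FiniteDimensional ℂ E]
  (Φ : (ι → ℝ) ≃L[ℝ] E) {n : ℕ} {η : E [⋀^Fin 2]→L[ℝ] ℝ} {d : Fin (n + 1) → ℕ}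

/-- **`(δ^* c_L)^* = Λ_ω` ON EVERY POLARIZED COMPLEX TORUS, ANY LATTICE BASIS** (`δ = pr₁ − pr₂`, `c_L = c₁(L)^{∧(g−1)}/(d₁⋯d_g (g−1)!)`, `ω = c₁(L) = −E`, in every
degree `m` and for all frames `e₁`, `e`): Layer A's `IsSymplecticEnum.corrMapT_pullbackForms_curveClass_eq_lefschetzDual_neg` (Milne's Thm. 5.9 for `Λ`,
Künnemann's / Polishchuk's convolution form) assumes the lattice basis symplectic; but `ᵗγ = corrMapT` depends only on the lattice
(`corrMapT_eq_of_range_latticeVec_eq`), the form `δ^* c_L = c_L ∘ (pr₁ − pr₂)` and the operator `Λ_ω` do not see the basis at all, and a polarized lattice has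
a symplectic re-presentation with the same lattice (`IsPolarizationType.exists_isSymplecticEnum`, elementary divisors).
[cite: Milne1999LefschetzClasses, §5 Thm. 5.9 with proof (p0026 L74 – p0027 L9)] [cite: Polishchuk2007FourierStable, §1 (p0003 L66–L69)]
[cite: Lange2023AbelianVarietiesComplex, §1.5.1 (p0051) and §2.5.3 (p0133)] [cite: VoisinHodgeI2002, §6.2.1 Lemma 6.19 and §11.3.3 (11.11)] -/
theorem corrMapT_pullbackForms_curveClass_eq_lefschetzDual_neg_of_isPolarizationType (hd : IsPolarizationType Φ η d) (hη : IsRiemannForm Φ η)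
    {j m : ℕ} (e₁ : Fin ((2 + j) + m) ≃ ι) (e : Fin (((2 + j) + (m + 2)) + 2 * n) ≃ ι ⊕ ι) :
    corrMapT Φ Φ e₁ e (pullbackForms (prodPeriod Φ Φ) Φ (fstMatrix ι ι - sndMatrix ι ι) (2 * n)
        (hη.isNSForm.curveClass Φ (∏ i, d i) n) : (E × E) [⋀^Fin (2 * n)]→L[ℝ] ℂ) =
      lefschetzDual (-η) m := by
  obtain ⟨-, b, -⟩ := id hd
  obtain ⟨Φ', hr, hs⟩ := hd.exists_isSymplecticEnum Φ
  have hη' : IsRiemannForm Φ' η := hη.of_range_latticeVec_subset hr.le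
  have hcard : Fintype.card ι = (n + 1) + (n + 1) := by
    rw [← Fintype.card_congr (b.indexEquiv (Pi.basisFun ℤ ι)), Fintype.card_sum, Fintype.card_fin]
  have h₁ : (2 + j) + m = (n + 1) + (n + 1) := by have h := Fintype.card_congr e₁; rw [Fintype.card_fin] at h; omega
  have h₂ : ((2 + j) + (m + 2)) + 2 * n = ((n + 1) + (n + 1)) + ((n + 1) + (n + 1)) := by omega
  letI : LinearOrder (Fin (n + 1) ⊕ Fin (n + 1)) :=
    linearOrderOfOrientation (finSumFinEquiv.symm : Fin ((n + 1) + (n + 1)) ≃ Fin (n + 1) ⊕ Fin (n + 1))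
  set e₁' : Fin ((2 + j) + m) ≃ Fin (n + 1) ⊕ Fin (n + 1) := (finCongr h₁).trans finSumFinEquiv.symm with he₁'
  set e' : Fin (((2 + j) + (m + 2)) + 2 * n) ≃ (Fin (n + 1) ⊕ Fin (n + 1)) ⊕ (Fin (n + 1) ⊕ Fin (n + 1)) :=
    (finCongr h₂).trans (finSumFinEquiv.symm.trans (Equiv.sumCongr finSumFinEquiv.symm finSumFinEquiv.symm)) with he'
  have hform : (pullbackForms (prodPeriod Φ' Φ') Φ' (fstMatrix (Fin (n + 1) ⊕ Fin (n + 1)) (Fin (n + 1) ⊕ Fin (n + 1)) -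
        sndMatrix (Fin (n + 1) ⊕ Fin (n + 1)) (Fin (n + 1) ⊕ Fin (n + 1))) (2 * n) (hη'.isNSForm.curveClass Φ' (∏ i, d i) n) : (E × E) [⋀^Fin (2 * n)]→L[ℝ] ℂ) =
      (pullbackForms (prodPeriod Φ Φ) Φ (fstMatrix ι ι - sndMatrix ι ι) (2 * n) (hη.isNSForm.curveClass Φ (∏ i, d i) n) : (E × E) [⋀^Fin (2 * n)]→L[ℝ] ℂ) := by
    rw [coe_pullbackForms_apply, coe_pullbackForms_apply, realRep_fstMatrix_sub_sndMatrix, realRep_fstMatrix_sub_sndMatrix, IsNSForm.coe_curveClass,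
      IsNSForm.coe_curveClass]
  rw [← corrMapT_eq_of_range_latticeVec_eq Φ Φ' hr e₁ e e₁' e', ← hform]
  exact hs.corrMapT_pullbackForms_curveClass_eq_lefschetzDual_neg Φ' hη' e₁' e'

end AnyBasis

namespace ComplexTorusCat

/-! ## §2 `Π_{Θ^{[g−1]}} = (d₁⋯d_g) · δ^* c_L` as forms on `E × E` -/

section Forms

variable {V W : Type*} [NormedAddCommGroup V] [NormedSpace ℝ V] [NormedAddCommGroup W] [NormedSpace ℝ W]

/-- `(c • γ) ∘ g = c • (γ ∘ g)`. [folklore] -/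
private theorem smul_compContinuousLinearMap₃₅ {k : ℕ} (c : ℂ) (γ : V [⋀^Fin k]→L[ℝ] ℂ) (g : W →L[ℝ] V) :
    (c • γ).compContinuousLinearMap g = c • γ.compContinuousLinearMap g := by
  ext v; rfl

/-- `(c • γ)` re-indexed is `c •` the re-indexed form. [folklore] -/
private theorem domDomCongr_finCongr_smul₃₅ {k k' : ℕ} (h : k = k') (c : ℂ) (γ : V [⋀^Fin k]→L[ℝ] ℂ) :
    (c • γ).domDomCongr (finCongr h) = c • γ.domDomCongr (finCongr h) := by
  subst h; rfl

end Forms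

section PontryaginForm

variable (X : ComplexTorusCat) {n gXX : ℕ} (eXX : Fin (2 * gXX) ≃ (prodObj X X).toIsog.ι) (hgXX : gXX + gXX = 2 * gXX) {L : ℕ} (hq : L + 2 * n = 2 * gXX)
  {θ : neronSeveriGroup X.toIsog.Φ} {tt : Fin (n + 1) → ℕ}
  (hθ : IsRiemannForm X.toIsog.Φ (θ : X.toIsog.E [⋀^Fin 2]→L[ℝ] ℝ)) (ht : IsPolarizationType X.toIsog.Φ (θ : X.toIsog.E [⋀^Fin 2]→L[ℝ] ℝ) tt)

/-- The analytic representation of `pr₁ − pr₂ : X × X → X` is `fst − snd`. [cite: Lange2023AbelianVarietiesComplex, §1.1.2 (p0021 L5–L8)] -/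
theorem realRep_fstHom_sub_sndHom : realRep (prodObj X X).toIsog.Φ X.toIsog.Φ (fstHom X X - sndHom X X).1 =
    ContinuousLinearMap.fst ℝ X.toIsog.E X.toIsog.E - ContinuousLinearMap.snd ℝ X.toIsog.E X.toIsog.E := by
  rw [show (fstHom X X - sndHom X X).1 = (fstHom X X).1 - (sndHom X X).1 from AddSubgroupClass.coe_sub _ _, realRep_sub, realRep_fstHom, realRep_sndHom]

include hθ ht in
/-- **`Π_{Θ^{[n]}} = (d₁⋯d_g) · δ^* c_L` as forms on `E × E`** (`g = n + 1`, `Θ = −θ = c₁(L)`, `δ = pr₁ − pr₂`): Künnemann's INTEGRAL Pontryagin correspondence of the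
divided power `Θ^{[g−1]} = ((g−1)!)⁻¹ c₁(L)^{∧(g−1)} ∈ Hdg^{g−1}(X, ℤ)` is `d₁⋯d_g` times the pull-back of Milne's / Lange's RATIONAL class `c_L = c₁(L)^{∧(g−1)}/(d₁⋯d_g
(g−1)!)` — `Π_c = (pr₁ − pr₂)^*c` (g34-#2), `ρ_r(pr₁ − pr₂) = fst − snd`, and `dᵢ > 0`. [cite: Lange2023AbelianVarietiesComplex, §6.3.2 (p0316 L14) and §6.3.4 (p0319 L28–L36)]
[cite: Milne1999LefschetzClasses, §5 Thm. 5.9 proof (p0027 L5–L9)] [cite: Polishchuk2007FourierStable, §1 (p0003 L66–L69)] -/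
theorem coe_pontryaginCorrespondence_nsDivPower_neg_eq_smul_pullbackForms_curveClass :
    ((integralHodgeClassesPushforward n n (liftHom (fstHom X X) (fstHom X X + sndHom X X)) eXX eXX hq hgXX hq hgXX
        (integralHodgeClassesPullbackHom (sndHom X X) n (nsDivPower X (-θ) n)) : integralHodgeClasses (prodObj X X).toIsog.Φ n) :
          (X.toIsog.E × X.toIsog.E) [⋀^Fin (2 * n)]→L[ℝ] ℂ) =
      ((∏ i, tt i : ℕ) : ℂ) • (pullbackForms (prodPeriod X.toIsog.Φ X.toIsog.Φ) X.toIsog.Φ (fstMatrix X.toIsog.ι X.toIsog.ι - sndMatrix X.toIsog.ι X.toIsog.ι) (2 * n)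
        (hθ.isNSForm.curveClass X.toIsog.Φ (∏ i, tt i) n) : (X.toIsog.E × X.toIsog.E) [⋀^Fin (2 * n)]→L[ℝ] ℂ) := by
  have hD : ((∏ i, tt i : ℕ) : ℂ) ≠ 0 := Nat.cast_ne_zero.2 (Finset.prod_ne_zero_iff.2 fun i _ ↦ (ht.pos hθ i).ne')
  rw [pontryaginCorrespondence_eq_pullbackHom_fstHom_sub_sndHom X eXX hgXX hq, coe_integralHodgeClassesPullbackHom_apply, realRep_fstHom_sub_sndHom,
    coe_pullbackForms_apply, realRep_fstMatrix_sub_sndMatrix, coe_nsDivPower, IsNSForm.coe_curveClass, NegMemClass.coe_neg, ComplexTorus.ofRealForm_neg,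
    smul_compContinuousLinearMap₃₅, smul_compContinuousLinearMap₃₅, smul_smul, mul_inv, ← mul_assoc, mul_inv_cancel₀ hD, one_mul]

end PontryaginForm

/-! ## §3 `(Π_{Θ^{[g−1]}})^*(y) = (d₁⋯d_g) · Λ_{c₁(L)}(y)` for every integral Hodge class `y` -/

section Headline

variable (X : ComplexTorusCat) {n gXX : ℕ} (eX : Fin (2 * (n + 1)) ≃ X.toIsog.ι) (eXX : Fin (2 * gXX) ≃ (prodObj X X).toIsog.ι)
  (hgX : (n + 1) + (n + 1) = 2 * (n + 1)) (hcX : 2 * (n + 1) + 2 * (n + 1) = 2 * gXX) (hgXX : gXX + gXX = 2 * gXX)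
  {L p s t m dY : ℕ} (hq : L + 2 * n = 2 * gXX) (hs : n + p = s) (hm : m + 2 * s = 2 * gXX) (hm' : m + 2 * t = 2 * (n + 1)) (hcd : 2 * n = 2 * t + dY)
  (hp : 2 * p = 2 * t + 2) {θ : neronSeveriGroup X.toIsog.Φ} {tt : Fin (n + 1) → ℕ}
  (hθ : IsRiemannForm X.toIsog.Φ (θ : X.toIsog.E [⋀^Fin 2]→L[ℝ] ℝ)) (ht : IsPolarizationType X.toIsog.Φ (θ : X.toIsog.E [⋀^Fin 2]→L[ℝ] ℝ) tt)

include hcX hcd hθ ht in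
/-- **KÜNNEMANN'S INTEGRAL `Λ`-CORRESPONDENCE INDUCES `(d₁⋯d_g) · Λ_{c₁(L)}` ON COHOMOLOGY.** Let `(X, θ)` be a polarized complex torus of dimension `g = n + 1` and type
`(d₁, …, d_g)`, `Θ = −θ = c₁(L) ∈ NS(X)`, `Π = Π_{Θ^{[g−1]}} = (s_X)_*(p₂^*Θ^{[g−1]}) ∈ Hdg^{g−1}(X × X, ℤ)` its integral Pontryagin correspondence (g33-#7; by g34-#8
`[Δ_*[Θ], Π] = (d₁⋯d_g) · H_X`, by g35-#1 the unique such correspondence of degree `−1`). Then for every integral Hodge class `y ∈ Hdgᵖ(X, ℤ) ⊂ H^{2p}(X, ℤ)`, the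
class `Π^*(y) = p_{1*}(Π · p₂^*y) ∈ Hdg^{p−1}(X, ℤ)` (Fulton's Def. 16.1.2; `= y ⋆ Θ^{[g−1]}`, g34-#1 §2) is, AS A FORM, `(d₁⋯d_g) · Λ_ω(y)` for Hodge theory's dual
Lefschetz operator `Λ_ω = lefschetzDual (−θ) (2p − 2)` of the Kähler class `ω = c₁(L)` (Layer A, Voisin's Lemma 6.19 / Huybrechts' Prop. 1.2.26: the adjoint of
`L_ω`, `[L, Λ] = H`): g29-#2's bridge `α^*(y) = corrMapT α y`, §2 `Π = (d₁⋯d_g) δ^*c_L`, `ℂ`-linearity of `γ ↦ ᵗγ`, and §1 `(δ^*c_L)^* = Λ_ω` (Milne's Thm. 5.9).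
Over `ℚ`: `(d₁⋯d_g)^{-1} Π_{c₁(L)^{[g−1]}}` — Polishchuk's "`f = (d^{g−1}/((g−1)! χ(d))) ∗ ·`" — INDUCES `Λ`: the Lefschetz standard conjecture `B(X)` for abelian
varieties with Künnemann's explicit algebraic cycle, read on the integral Hodge classes of every codimension. (`t = p − 1`; `y` re-indexed along `2p = 2t + 2`.)
[cite: Milne1999LefschetzClasses, §5 Thm. 5.9 with proof (p0026 L74 – p0027 L9)] [cite: Polishchuk2007FourierStable, §1 (p0003 L66–L69)]
[cite: Moonen2011ChowMotiveAbelianSchemes, §5 (p0015 L2–L5)] [cite: GreenMurreVoisin1994, Murre Ch. 7 §7.7 (p0122 L19–L25)] [cite: Fulton1998, §16.1 Def. 16.1.2 (p0295 L13–L17)]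
[cite: VoisinHodgeI2002, §6.2.1 Lemma 6.19 and §11.3.3 (11.11)] -/
theorem coe_integralHodgeClassesPushforward_fstHom_pontryaginCorrespondence_nsDivPower_cup_pullbackHom_sndHom_eq_smul_lefschetzDual
    (y : integralHodgeClasses X.toIsog.Φ p) :
    ((integralHodgeClassesPushforward s t (fstHom X X) eXX eX hm hgXX hm' hgX
        (integralHodgeClassesCup (prodObj X X).toIsog.Φ hs
          (integralHodgeClassesPushforward n n (liftHom (fstHom X X) (fstHom X X + sndHom X X)) eXX eXX hq hgXX hq hgXX
            (integralHodgeClassesPullbackHom (sndHom X X) n (nsDivPower X (-θ) n)))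
          (integralHodgeClassesPullbackHom (sndHom X X) p y)) : integralHodgeClasses X.toIsog.Φ t) : X.toIsog.E [⋀^Fin (2 * t)]→L[ℝ] ℂ) =
      ((∏ i, tt i : ℕ) : ℂ) • lefschetzDual (-(θ : X.toIsog.E [⋀^Fin 2]→L[ℝ] ℝ)) (2 * t)
        (((y : integralHodgeClasses X.toIsog.Φ p) : X.toIsog.E [⋀^Fin (2 * p)]→L[ℝ] ℂ).domDomCongr (finCongr hp)) := by
  set eY : Fin (2 * p + dY) ≃ X.toIsog.ι := (finCongr (by omega : 2 * p + dY = 2 * (n + 1))).trans eX with heY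
  set e₁ : Fin ((2 + (2 * n - 2 * t)) + 2 * t) ≃ X.toIsog.ι := (finCongr (by omega : (2 + (2 * n - 2 * t)) + 2 * t = 2 * (n + 1))).trans eX with he₁
  set eP : Fin (((2 + (2 * n - 2 * t)) + 2 * p) + (2 * t + dY)) ≃ X.toIsog.ι ⊕ X.toIsog.ι :=
    (finCongr (by omega : ((2 + (2 * n - 2 * t)) + 2 * p) + (2 * t + dY) = 2 * gXX)).trans eXX with heP
  set e : Fin (((2 + (2 * n - 2 * t)) + 2 * p) + 2 * n) ≃ X.toIsog.ι ⊕ X.toIsog.ι :=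
    (finCongr (by omega : ((2 + (2 * n - 2 * t)) + 2 * p) + 2 * n = 2 * gXX)).trans eXX with he
  set e' : Fin (((2 + (2 * n - 2 * t)) + (2 * t + 2)) + 2 * n) ≃ X.toIsog.ι ⊕ X.toIsog.ι :=
    (finCongr (by omega : ((2 + (2 * n - 2 * t)) + (2 * t + 2)) + 2 * n = 2 * gXX)).trans eXX with he'
  rw [coe_integralHodgeClassesPushforward_fstHom_cup_pullbackHom_sndHom_eq_corrMapT eXX eX eY hs hm hgXX hm' hgX hcd e₁ eP,
    coe_pontryaginCorrespondence_nsDivPower_neg_eq_smul_pullbackForms_curveClass X eXX hgXX hq hθ ht, domDomCongr_finCongr_smul₃₅, corrMapT_smul,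
    LinearMap.smul_apply, corrMapT_domDomCongr_finCongr X.toIsog.Φ X.toIsog.Φ e₁ e eP hcd,
    ← corrMapT_apply_domDomCongr X.toIsog.Φ X.toIsog.Φ hp e₁ e e',
    corrMapT_pullbackForms_curveClass_eq_lefschetzDual_neg_of_isPolarizationType X.toIsog.Φ ht hθ e₁ e']

variable {t₁ : Fin (n + 1) → ℕ} (ht₁ : IsPolarizationType X.toIsog.Φ (θ : X.toIsog.E [⋀^Fin 2]→L[ℝ] ℝ) t₁) (hd₁ : ∀ i, t₁ i = 1)

include hcX hcd hθ ht₁ hd₁ in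
/-- **For a PRINCIPALLY polarized complex torus, Künnemann's integral correspondence `Π_{Θ^{[g−1]}}` induces Hodge theory's `Λ_{c₁(L)}` ON THE NOSE**: `(Π_{Θ^{[g−1]}})^*(y)
= Λ_ω(y)` as forms, for every `y ∈ Hdgᵖ(X, ℤ)` (type `(1, …, 1)`, `d₁⋯d_g = 1`). With g34-#6 §4 / g34-#8 (`[Δ_*[Θ], Π] = H_X`) and g35-#1 (uniqueness): on a principally
polarized abelian variety the integral `𝔰𝔩₂`-triplet `(Δ_*[c₁(L)], Π_{c₁(L)^{[g−1]}}, H_X)` of algebraic correspondences induces the Lefschetz triple `(L, Λ, H)` of Hodge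
theory. [cite: Milne1999LefschetzClasses, §5 Thm. 5.9 (p0026 L74–L75)] [cite: Moonen2011ChowMotiveAbelianSchemes, §5 (p0015 L2–L5)] [cite: VoisinHodgeI2002, §6.2.1 Lemma 6.19] -/
theorem coe_integralHodgeClassesPushforward_fstHom_pontryaginCorrespondence_nsDivPower_cup_pullbackHom_sndHom_eq_lefschetzDual_of_principal
    (y : integralHodgeClasses X.toIsog.Φ p) :
    ((integralHodgeClassesPushforward s t (fstHom X X) eXX eX hm hgXX hm' hgX
        (integralHodgeClassesCup (prodObj X X).toIsog.Φ hs
          (integralHodgeClassesPushforward n n (liftHom (fstHom X X) (fstHom X X + sndHom X X)) eXX eXX hq hgXX hq hgXX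
            (integralHodgeClassesPullbackHom (sndHom X X) n (nsDivPower X (-θ) n)))
          (integralHodgeClassesPullbackHom (sndHom X X) p y)) : integralHodgeClasses X.toIsog.Φ t) : X.toIsog.E [⋀^Fin (2 * t)]→L[ℝ] ℂ) =
      lefschetzDual (-(θ : X.toIsog.E [⋀^Fin 2]→L[ℝ] ℝ)) (2 * t)
        (((y : integralHodgeClasses X.toIsog.Φ p) : X.toIsog.E [⋀^Fin (2 * p)]→L[ℝ] ℂ).domDomCongr (finCongr hp)) := by
  rw [coe_integralHodgeClassesPushforward_fstHom_pontryaginCorrespondence_nsDivPower_cup_pullbackHom_sndHom_eq_smul_lefschetzDual X eX eXX hgX hcX hgXX hq hs hm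
      hm' hcd hp hθ ht₁ y, Finset.prod_eq_one fun i _ ↦ hd₁ i, Nat.cast_one, one_smul]

end Headline

/-! ## §4 The covariant action `(Π_{Θ^{[g−1]}})_*(x) = (d₁⋯d_g) · Λ_{c₁(L)}(x)`, and `(d₁⋯d_g) · Λ_{c₁(L)}` preserves integral Hodge classes -/

section Covariant

variable (X : ComplexTorusCat) {n gXX : ℕ} (eX : Fin (2 * (n + 1)) ≃ X.toIsog.ι) (eXX : Fin (2 * gXX) ≃ (prodObj X X).toIsog.ι)
  (hgX : (n + 1) + (n + 1) = 2 * (n + 1)) (hcX : 2 * (n + 1) + 2 * (n + 1) = 2 * gXX) (hgXX : gXX + gXX = 2 * gXX)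
  {L p s t m dY : ℕ} (hq : L + 2 * n = 2 * gXX) (hs : n + p = s) (hps : p + n = s) (hm : m + 2 * s = 2 * gXX) (hm' : m + 2 * t = 2 * (n + 1))
  (hcd : 2 * n = 2 * t + dY) (hp : 2 * p = 2 * t + 2) {θ : neronSeveriGroup X.toIsog.Φ} {tt : Fin (n + 1) → ℕ}
  (hθ : IsRiemannForm X.toIsog.Φ (θ : X.toIsog.E [⋀^Fin 2]→L[ℝ] ℝ)) (ht : IsPolarizationType X.toIsog.Φ (θ : X.toIsog.E [⋀^Fin 2]→L[ℝ] ℝ) tt)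

include hcX hcd hps hθ ht in
/-- **THE COVARIANT ACTION: `(Π_{Θ^{[g−1]}})_*(x) = p_{2*}(Π · p₁^*x) = (d₁⋯d_g) · Λ_{c₁(L)}(x)` as forms**, for every `x ∈ Hdgᵖ(X, ℤ)` — `Π_c` is a SYMMETRIC correspondence, so
`(Π_c)_*(x) = x ⋆ c = (Π_c)^*(x)` (g33-#7 §2, g34-#1 §1–§2: Fulton's `(α′)_* = α^*` with `Π_c′ = Π_c`), and §3. (Voisin's `α̃ = corrMap` of the even class `δ^*c_L`
equals its `corrMapT` by the same symmetry; Layer A `IsSymplecticEnum.corrMap_pullbackForms_curveClass_eq_neg_one_pow_smul_lefschetzDual_neg` with `m = 2t` even.)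
[cite: Fulton1998, §16.1 Def. 16.1.2 and Prop. 16.1.2 (b) (p0295 L9–L27)] [cite: Polishchuk2007FourierStable, §1 (p0003 L66–L69)] [cite: Milne1999LefschetzClasses, §5 Thm. 5.9 (p0026 L74–L75)]
[cite: VoisinHodgeI2002, §11.3.3 (11.11) and Lemma 11.41] -/
theorem coe_integralHodgeClassesPushforward_sndHom_pontryaginCorrespondence_nsDivPower_cup_pullbackHom_fstHom_eq_smul_lefschetzDual
    (x : integralHodgeClasses X.toIsog.Φ p) :
    ((integralHodgeClassesPushforward s t (sndHom X X) eXX eX hm hgXX hm' hgX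
        (integralHodgeClassesCup (prodObj X X).toIsog.Φ hs
          (integralHodgeClassesPushforward n n (liftHom (fstHom X X) (fstHom X X + sndHom X X)) eXX eXX hq hgXX hq hgXX
            (integralHodgeClassesPullbackHom (sndHom X X) n (nsDivPower X (-θ) n)))
          (integralHodgeClassesPullbackHom (fstHom X X) p x)) : integralHodgeClasses X.toIsog.Φ t) : X.toIsog.E [⋀^Fin (2 * t)]→L[ℝ] ℂ) =
      ((∏ i, tt i : ℕ) : ℂ) • lefschetzDual (-(θ : X.toIsog.E [⋀^Fin 2]→L[ℝ] ℝ)) (2 * t)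
        (((x : integralHodgeClasses X.toIsog.Φ p) : X.toIsog.E [⋀^Fin (2 * p)]→L[ℝ] ℂ).domDomCongr (finCongr hp)) := by
  rw [integralHodgeClassesPushforward_sndHom_pontryaginCorrespondence_cup_pullbackHom_fstHom X eX eXX hgX hgXX hq hs hps hm hm',
    ← integralHodgeClassesPushforward_fstHom_pontryaginCorrespondence_cup_pullbackHom_sndHom X eX eXX hgX hgXX hq hs hps hm hm',
    coe_integralHodgeClassesPushforward_fstHom_pontryaginCorrespondence_nsDivPower_cup_pullbackHom_sndHom_eq_smul_lefschetzDual X eX eXX hgX hcX hgXX hq hs hm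
      hm' hcd hp hθ ht]

include hcX hq hs hcd hθ ht in
/-- **`x ⋆ c₁(L)^{[g−1]} = (d₁⋯d_g) · Λ_{c₁(L)}(x)` as forms**: the INTEGRAL Pontryagin product with the divided power `Θ^{[g−1]}` (g31-#4 `integralHodgeClassesPontryagin`,
`x ⋆ y = μ_*(x ⊠ y)`) is `d₁⋯d_g` times the dual Lefschetz operator on every integral Hodge class — Polishchuk's / Künnemann's `f(x) = (d^{g−1}/((g−1)! χ(d))) ∗ x`
with `χ = d₁⋯d_g`, integrally. [cite: Polishchuk2007FourierStable, §1 (p0003 L66–L69)] [cite: Lange2023AbelianVarietiesComplex, §6.2.3 (p0308 L3–L7) and §6.3.2 (p0316 L14)]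
[cite: VoisinHodgeI2002, §6.2.1 Lemma 6.19] -/
theorem coe_integralHodgeClassesPontryagin_nsDivPower_neg_eq_smul_lefschetzDual (x : integralHodgeClasses X.toIsog.Φ p) :
    ((integralHodgeClassesPontryagin X eX eXX hgX hgXX hps hm hm' x (nsDivPower X (-θ) n) : integralHodgeClasses X.toIsog.Φ t) :
        X.toIsog.E [⋀^Fin (2 * t)]→L[ℝ] ℂ) =
      ((∏ i, tt i : ℕ) : ℂ) • lefschetzDual (-(θ : X.toIsog.E [⋀^Fin 2]→L[ℝ] ℝ)) (2 * t)
        (((x : integralHodgeClasses X.toIsog.Φ p) : X.toIsog.E [⋀^Fin (2 * p)]→L[ℝ] ℂ).domDomCongr (finCongr hp)) := by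
  rw [← integralHodgeClassesPushforward_fstHom_pontryaginCorrespondence_cup_pullbackHom_sndHom X eX eXX hgX hgXX hq hs hps hm hm',
    coe_integralHodgeClassesPushforward_fstHom_pontryaginCorrespondence_nsDivPower_cup_pullbackHom_sndHom_eq_smul_lefschetzDual X eX eXX hgX hcX hgXX hq hs hm
      hm' hcd hp hθ ht]

include eX eXX hgX hcX hgXX hq hs hm hm' hcd hθ ht in
/-- **`(d₁⋯d_g) · Λ_{c₁(L)}` PRESERVES INTEGRAL HODGE CLASSES**: for every `y ∈ Hdgᵖ(X, ℤ) = H^{2p}(X, ℤ) ∩ H^{p,p}` the form `(d₁⋯d_g) · Λ_ω(y)` is again an integral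
Hodge class, in `Hdg^{p−1}(X, ℤ)` — it is the class `(Π_{Θ^{[g−1]}})^*(y)` of the integral series (§3). The dual Lefschetz operator of a polarization of type
`(d₁, …, d_g)` has denominators dividing `d₁⋯d_g` on integral Hodge classes; Layer A knew `Λ_ω(y)` to be a RATIONAL Hodge class (`lefschetzDual_mem_hodgeClassesIn`,
`lefschetzDual_mem_rationalForms`). [cite: Milne1999LefschetzClasses, §5 Thm. 5.9 (p0026 L74–L75)] [cite: Polishchuk2007FourierStable, §1 (p0003 L66–L69)]
[cite: VoisinHodgeI2002, §11.3.3 Lemma 11.41 and §7.1.2] -/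
theorem smul_lefschetzDual_neg_mem_integralHodgeClasses (y : integralHodgeClasses X.toIsog.Φ p) :
    ((∏ i, tt i : ℕ) : ℂ) • lefschetzDual (-(θ : X.toIsog.E [⋀^Fin 2]→L[ℝ] ℝ)) (2 * t)
        (((y : integralHodgeClasses X.toIsog.Φ p) : X.toIsog.E [⋀^Fin (2 * p)]→L[ℝ] ℂ).domDomCongr (finCongr hp)) ∈
      integralHodgeClasses X.toIsog.Φ t := by
  rw [← coe_integralHodgeClassesPushforward_fstHom_pontryaginCorrespondence_nsDivPower_cup_pullbackHom_sndHom_eq_smul_lefschetzDual X eX eXX hgX hcX hgXX hq hs hm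
    hm' hcd hp hθ ht y]
  exact SetLike.coe_mem _

variable {t₁ : Fin (n + 1) → ℕ} (ht₁ : IsPolarizationType X.toIsog.Φ (θ : X.toIsog.E [⋀^Fin 2]→L[ℝ] ℝ) t₁) (hd₁ : ∀ i, t₁ i = 1)

include eX eXX hgX hcX hgXX hq hs hm hm' hcd hθ ht₁ hd₁ in
/-- **On a PRINCIPALLY polarized complex torus, Hodge theory's `Λ_{c₁(L)}` maps `H^{2p}(X, ℤ) ∩ H^{p,p}` into `H^{2p−2}(X, ℤ) ∩ H^{p−1,p−1}`**: the dual Lefschetz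
operator of a principal polarization is INTEGRAL on integral Hodge classes (it is induced there by the integral cycle class `Π_{Θ^{[g−1]}}`, §3).
[cite: Milne1999LefschetzClasses, §5 Thm. 5.9 (p0026 L74–L75)] [cite: Moonen2011ChowMotiveAbelianSchemes, §5 (p0015 L2–L5)] [cite: VoisinHodgeI2002, §11.3.3 Lemma 11.41] -/
theorem lefschetzDual_neg_mem_integralHodgeClasses_of_principal (y : integralHodgeClasses X.toIsog.Φ p) :
    lefschetzDual (-(θ : X.toIsog.E [⋀^Fin 2]→L[ℝ] ℝ)) (2 * t)
        (((y : integralHodgeClasses X.toIsog.Φ p) : X.toIsog.E [⋀^Fin (2 * p)]→L[ℝ] ℂ).domDomCongr (finCongr hp)) ∈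
      integralHodgeClasses X.toIsog.Φ t := by
  have h := smul_lefschetzDual_neg_mem_integralHodgeClasses X eX eXX hgX hcX hgXX hq hs hm hm' hcd hp hθ ht₁ y
  rwa [Finset.prod_eq_one fun i _ ↦ hd₁ i, Nat.cast_one, one_smul] at h

end Covariant

/-! ## §5 The Lefschetz side: `(Δ_*[Θ])_*(x) = L_Θ(x)`, `(Δ_*[Θ])^*(y) = L_Θ(y)` are Layer A's `lefschetzPow Θ 1` -/

section Lefschetz

variable (X : ComplexTorusCat) {gX gXX : ℕ} (eX : Fin (2 * gX) ≃ X.toIsog.ι) (eXX : Fin (2 * gXX) ≃ (prodObj X X).toIsog.ι)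
  (hgX : gX + gX = 2 * gX) (hgXX : gXX + gXX = 2 * gXX) {c₁ l : ℕ} (hl : l + 2 * 1 = 2 * gX) (hl' : l + 2 * c₁ = 2 * gXX)
  {p s t m : ℕ} (hs : c₁ + p = s) (ht : 1 + p = t) (hm : m + 2 * s = 2 * gXX) (hm' : m + 2 * t = 2 * gX) (h2 : 2 * 1 + 2 * p = 2 * t)
  (Θ : neronSeveriGroup X.toIsog.Φ)

/-- `1 ∧ η = η` up to the reindexing `0 + 2 = 2`, for the constant `0`-form `1`. [cite: Lange2023AbelianVarietiesComplex, §7.3.1] -/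
private theorem wedgePow_one_eq_domDomCongr₃₅ {V : Type*} [NormedAddCommGroup V] [NormedSpace ℂ V] (Ω : V [⋀^Fin 2]→L[ℝ] ℂ) :
    wedgePow Ω 1 = Ω.domDomCongr (finCongr (Nat.zero_add 2).symm) := by
  rw [wedgePow_one, Literature.Analysis.Complex.oneForm₀, ContinuousAlternatingMap.constOfIsEmpty_one_wedge]

/-- Reindexing the left factor of a wedge. [folklore] -/
private theorem domDomCongr_finCongr_wedge₃₅ {V : Type*} [NormedAddCommGroup V] [NormedSpace ℂ V] {a a' b : ℕ} (h : a = a') (α : V [⋀^Fin a]→L[ℝ] ℂ)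
    (β : V [⋀^Fin b]→L[ℝ] ℂ) : (α.domDomCongr (finCongr h)).wedge β = (α.wedge β).domDomCongr (finCongr (congrArg (· + b) h)) := by
  subst h; rfl

/-- Two successive reindexings. [folklore] -/
private theorem domDomCongr_finCongr_domDomCongr_finCongr₃₅ {V : Type*} [NormedAddCommGroup V] [NormedSpace ℂ V] {k k' k'' : ℕ} (h : k = k') (h' : k' = k'')
    (γ : V [⋀^Fin k]→L[ℝ] ℂ) : (γ.domDomCongr (finCongr h)).domDomCongr (finCongr h') = γ.domDomCongr (finCongr (h.trans h')) := by
  subst h h'; rfl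

include hl hl' hs ht in
/-- **THE LEFSCHETZ CORRESPONDENCE INDUCES LAYER A's LEFSCHETZ OPERATOR: `((Δ_*[Θ])_*(x) : form) = lefschetzPow Θ 1 (x : form)`** for every `Θ ∈ NS(X)` and every
`x ∈ Hdgᵖ(X, ℤ)` — `(Δ_*u)_*(a) = u · a` (g33-#3 §2, Fulton's Example 16.1.14 (ii): the multiplication correspondence induces the cup product) and Layer A's
`lefschetzPow η 1 : ψ ↦ η^{∧1} ∧ ψ` (`ComplexTorusLefschetzDecomposition`, Lange §7.3.2 "`L : u ↦ E ∧ u`"). With §3/§4 and g33-#5's `H_*(x) = (2p − g) x`: the integral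
triple `(Δ_*[c₁(L)], Π_{c₁(L)^{[g−1]}}, H_X)` of algebraic correspondences induces `(L_ω, (d₁⋯d_g) Λ_ω, H)` of Hodge theory on `Hdg•(X, ℤ)`.
[cite: Fulton1998, §16.1 Example 16.1.14 (ii) (p0302 L14–L20) and Def. 16.1.2 (p0295 L9–L13)] [cite: Lange2023AbelianVarietiesComplex, §7.3.2 (p0338)]
[cite: CattaniElZeinGriffithsLe2014, Ch. 11 §11.2 (p0471 L25: "L is induced by an algebraic correspondence")] -/
theorem coe_integralHodgeClassesPushforward_sndHom_pushforward_diagHom_cup_pullbackHom_fstHom_eq_lefschetzPow (x : integralHodgeClasses X.toIsog.Φ p) :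
    ((integralHodgeClassesPushforward s t (sndHom X X) eXX eX hm hgXX hm' hgX
        (integralHodgeClassesCup (prodObj X X).toIsog.Φ hs
          (integralHodgeClassesPushforward 1 c₁ (diagHom X) eX eXX hl hgX hl' hgXX (neronSeveriGroupEquiv X.toIsog.Φ Θ))
          (integralHodgeClassesPullbackHom (fstHom X X) p x)) : integralHodgeClasses X.toIsog.Φ t) : X.toIsog.E [⋀^Fin (2 * t)]→L[ℝ] ℂ) =
      lefschetzPow (Θ : X.toIsog.E [⋀^Fin 2]→L[ℝ] ℝ) 1 h2 ((x : integralHodgeClasses X.toIsog.Φ p) : X.toIsog.E [⋀^Fin (2 * p)]→L[ℝ] ℂ) := by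
  rw [integralHodgeClassesPushforward_sndHom_pushforward_diagHom_cup_pullbackHom_fstHom X eX eXX hgX hgXX hl hl' hs ht hm hm', coe_integralHodgeClassesCup,
    coe_neronSeveriGroupEquiv_apply, lefschetzPow_apply, wedgePow_one_eq_domDomCongr₃₅, domDomCongr_finCongr_wedge₃₅, domDomCongr_finCongr_domDomCongr_finCongr₃₅]

include hl hl' hs ht in
/-- **… and `((Δ_*[Θ])^*(y) : form) = lefschetzPow Θ 1 (y : form)`** (`(Δ_*u)^*(b) = u · b`, g33-#3 §2; `Δ_*[Θ]′ = Δ_*[Θ]`).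
[cite: Fulton1998, §16.1 Example 16.1.14 (ii) (p0302 L14–L20) and Def. 16.1.2 (p0295 L13–L15)] [cite: Lange2023AbelianVarietiesComplex, §7.3.2 (p0338)] -/
theorem coe_integralHodgeClassesPushforward_fstHom_pushforward_diagHom_cup_pullbackHom_sndHom_eq_lefschetzPow (y : integralHodgeClasses X.toIsog.Φ p) :
    ((integralHodgeClassesPushforward s t (fstHom X X) eXX eX hm hgXX hm' hgX
        (integralHodgeClassesCup (prodObj X X).toIsog.Φ hs
          (integralHodgeClassesPushforward 1 c₁ (diagHom X) eX eXX hl hgX hl' hgXX (neronSeveriGroupEquiv X.toIsog.Φ Θ))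
          (integralHodgeClassesPullbackHom (sndHom X X) p y)) : integralHodgeClasses X.toIsog.Φ t) : X.toIsog.E [⋀^Fin (2 * t)]→L[ℝ] ℂ) =
      lefschetzPow (Θ : X.toIsog.E [⋀^Fin 2]→L[ℝ] ℝ) 1 h2 ((y : integralHodgeClasses X.toIsog.Φ p) : X.toIsog.E [⋀^Fin (2 * p)]→L[ℝ] ℂ) := by
  rw [integralHodgeClassesPushforward_fstHom_pushforward_diagHom_cup_pullbackHom_sndHom X eX eXX hgX hgXX hl hl' hs ht hm hm', coe_integralHodgeClassesCup,
    coe_neronSeveriGroupEquiv_apply, lefschetzPow_apply, wedgePow_one_eq_domDomCongr₃₅, domDomCongr_finCongr_wedge₃₅, domDomCongr_finCongr_domDomCongr_finCongr₃₅]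

end Lefschetz

/-! ## §6 Uniqueness in Layer A's language: every integral correspondence `Λ′` of degree `−1` with `[Δ_*[Θ], Λ′] = D′ · H_X` induces `D′ · Λ_{c₁(L)}` on `H•(X, ℂ)` -/

section Uniqueness

variable (X : ComplexTorusCat) {n gXX gT : ℕ} (eX : Fin (2 * (n + 1)) ≃ X.toIsog.ι) (eXX : Fin (2 * gXX) ≃ (prodObj X X).toIsog.ι)
  (eT : Fin (2 * gT) ≃ (prodObj X (prodObj X X)).toIsog.ι) (hX0 : 2 * (n + 1) + 2 * 0 = 2 * (n + 1)) (hgX : (n + 1) + (n + 1) = 2 * (n + 1))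
  (hcX : 2 * (n + 1) + 2 * (n + 1) = 2 * gXX) (hgXX : gXX + gXX = 2 * gXX) (hgT : gT + gT = 2 * gT) (hN : 2 * (n + 1) + 2 * gXX = 2 * gT)
  (hgg₀ : (n + 1) + gXX = gT) (hXX0 : 2 * gXX + 2 * 0 = 2 * gXX) (hlr₀ : 2 * gXX + 2 * (n + 1) = 2 * gT) (hXXg : (n + 1) + (n + 1) = gXX) {C : ℕ}
  (hCC : (n + 1) + (n + 1) = C) (hC : 2 * (n + 1) + 2 * C = 2 * gT) {c₁ K₁ K₂ l l₃ l₃' L Lm : ℕ} (hl : l + 2 * 1 = 2 * (n + 1)) (hl' : l + 2 * c₁ = 2 * gXX)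
  (hq : L + 2 * n = 2 * gXX) (hK₁ : c₁ + n = K₁) (h3₁ : l₃ + 2 * K₁ = 2 * gT) (h3₁' : l₃ + 2 * (n + 1) = 2 * gXX) (hK₂ : n + c₁ = K₂) (h3₂ : l₃' + 2 * K₂ = 2 * gT)
  (h3₂' : l₃' + 2 * (n + 1) = 2 * gXX) (hqm : Lm + 2 * (n + 1) = 2 * gXX) {p s t m dY : ℕ} (hs : n + p = s) (hps : p + n = s) (hm : m + 2 * s = 2 * gXX)
  (hm' : m + 2 * t = 2 * (n + 1)) (hcd : 2 * n = 2 * t + dY) (hp : 2 * p = 2 * t + 2) {θ : neronSeveriGroup X.toIsog.Φ} {tt : Fin (n + 1) → ℕ}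
  (hθ : IsRiemannForm X.toIsog.Φ (θ : X.toIsog.E [⋀^Fin 2]→L[ℝ] ℝ)) (ht : IsPolarizationType X.toIsog.Φ (θ : X.toIsog.E [⋀^Fin 2]→L[ℝ] ℝ) tt)
  (Λ' : integralHodgeClasses (prodObj X X).toIsog.Φ n) (D' : ℤ)
  (hΛ' : integralHodgeClassesPushforward K₂ (n + 1) (liftHom (fstHom X (prodObj X X)) (sndHom X (prodObj X X) ≫ sndHom X X)) eT eXX h3₂ hgT h3₂' hgXX
      (integralHodgeClassesCup (prodObj X (prodObj X X)).toIsog.Φ hK₂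
        (integralHodgeClassesPullbackHom (liftHom (fstHom X (prodObj X X)) (sndHom X (prodObj X X) ≫ fstHom X X)) n Λ')
        (integralHodgeClassesPullbackHom (sndHom X (prodObj X X)) c₁
          (integralHodgeClassesPushforward 1 c₁ (diagHom X) eX eXX hl hgX hl' hgXX (neronSeveriGroupEquiv X.toIsog.Φ (-θ))))) -
    integralHodgeClassesPushforward K₁ (n + 1) (liftHom (fstHom X (prodObj X X)) (sndHom X (prodObj X X) ≫ sndHom X X)) eT eXX h3₁ hgT h3₁' hgXX
      (integralHodgeClassesCup (prodObj X (prodObj X X)).toIsog.Φ hK₁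
        (integralHodgeClassesPullbackHom (liftHom (fstHom X (prodObj X X)) (sndHom X (prodObj X X) ≫ fstHom X X)) c₁
          (integralHodgeClassesPushforward 1 c₁ (diagHom X) eX eXX hl hgX hl' hgXX (neronSeveriGroupEquiv X.toIsog.Φ (-θ))))
        (integralHodgeClassesPullbackHom (sndHom X (prodObj X X)) n Λ')) =
    D' • kunnethGrading X eX eXX hX0 hgX hcX hgXX)

/-- Cancellation of a non-zero complex scalar against an integer multiple on forms. Private helper. [folklore] -/
private theorem eq_smul_of_smul_eq_smul_smul₃₅ {V : Type*} [AddCommGroup V] [Module ℂ V] {c : ℂ} (hc : c ≠ 0) {D' : ℤ} {u v : V}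
    (h : c • u = (D' : ℂ) • c • v) : u = (D' : ℂ) • v := by
  rw [smul_comm] at h
  exact smul_right_injective V hc h

include eT hX0 hcX hgT hN hgg₀ hXX0 hlr₀ hXXg hCC hC hl hl' hq hK₁ h3₁ h3₁' hK₂ h3₂ h3₂' hqm hcd hθ ht hΛ' in
/-- **EVERY INTEGRAL CORRESPONDENCE `Λ′ ∈ Hdg^{g−1}(X × X, ℤ)` WITH `Δ_*[Θ] ∘ Λ′ − Λ′ ∘ Δ_*[Θ] = D′ · H_X` INDUCES `D′ · Λ_{c₁(L)}` ON COHOMOLOGY**: `(Λ′^*(y) : form) =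
D′ · Λ_ω(y)` for every `y ∈ Hdgᵖ(X, ℤ)` — on a polarized complex torus `(X, θ)` of ANY type `(d₁, …, d_g)` (`Θ = −θ = c₁(L)`, `ω` its Kähler class). Bourbaki's Lemma 1
in the integral correspondence ring (g35-#1: `(d₁⋯d_g) · Λ′ = D′ · Π_{Θ^{[g−1]}}`) and §3 (`Π^* = (d₁⋯d_g) · Λ_ω` as forms), divided by `d₁⋯d_g ≠ 0` in the `ℂ`-vector
space of forms: Hodge theory's `Λ` is pinned down, among the actions of integral algebraic correspondences of degree `−1`, by the single relation `[L, Λ] = H` —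
Looijenga–Lunts' uniqueness of the `𝔰𝔩₂`-partner (Layer A `eq_lefschetzDualG_of_isSl2Triple`, which needs the full triple on ALL forms) read on integral classes.
[cite: Bourbaki2008LieGroups79, Ch. VIII §11 no. 1 Lemma 1 (p0203 L3–L5)] [cite: LooijengaLunts1997, §1 (1.1)] [cite: Moonen2011ChowMotiveAbelianSchemes, §5 (p0015 L2–L5)]
[cite: Milne1999LefschetzClasses, §5 Thm. 5.9 (p0026 L74–L75)] -/
theorem coe_integralHodgeClassesPushforward_fstHom_cup_pullbackHom_sndHom_eq_smul_lefschetzDual_of_sub_eq_zsmul_kunnethGrading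
    (y : integralHodgeClasses X.toIsog.Φ p) :
    ((integralHodgeClassesPushforward s t (fstHom X X) eXX eX hm hgXX hm' hgX
        (integralHodgeClassesCup (prodObj X X).toIsog.Φ hs Λ' (integralHodgeClassesPullbackHom (sndHom X X) p y)) : integralHodgeClasses X.toIsog.Φ t) :
          X.toIsog.E [⋀^Fin (2 * t)]→L[ℝ] ℂ) =
      (D' : ℂ) • lefschetzDual (-(θ : X.toIsog.E [⋀^Fin 2]→L[ℝ] ℝ)) (2 * t)
        (((y : integralHodgeClasses X.toIsog.Φ p) : X.toIsog.E [⋀^Fin (2 * p)]→L[ℝ] ℂ).domDomCongr (finCongr hp)) := by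
  have hD : ((∏ i, tt i : ℕ) : ℂ) ≠ 0 := Nat.cast_ne_zero.2 (Finset.prod_ne_zero_iff.2 fun i _ ↦ (ht.pos hθ i).ne')
  have h1 := zsmul_eq_zsmul_pontryaginCorrespondence_nsDivPower_of_isPolarizationType X eX eXX eT hX0 hgX hcX hgXX hgT hN hgg₀ hXX0 hlr₀ hXXg hCC hC hl hl'
    hq hK₁ h3₁ h3₁' (Nat.add_comm 1 n) rfl hK₂ h3₂ h3₂' hqm hθ ht Λ' D' hΛ'
  have h2 := congrArg (fun β : integralHodgeClasses (prodObj X X).toIsog.Φ n ↦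
    ((integralHodgeClassesPushforward s t (fstHom X X) eXX eX hm hgXX hm' hgX
        (integralHodgeClassesCup (prodObj X X).toIsog.Φ hs β (integralHodgeClassesPullbackHom (sndHom X X) p y)) : integralHodgeClasses X.toIsog.Φ t) :
          X.toIsog.E [⋀^Fin (2 * t)]→L[ℝ] ℂ)) h1
  dsimp only at h2
  rw [integralHodgeClassesCup_zsmul_left, integralHodgeClassesCup_zsmul_left, map_zsmul, map_zsmul, AddSubgroupClass.coe_zsmul,
    AddSubgroupClass.coe_zsmul] at h2
  rw [coe_integralHodgeClassesPushforward_fstHom_pontryaginCorrespondence_nsDivPower_cup_pullbackHom_sndHom_eq_smul_lefschetzDual X eX eXX hgX hcX hgXX hq hs hm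
      hm' hcd hp hθ ht y, ← Int.cast_smul_eq_zsmul ℂ, ← Int.cast_smul_eq_zsmul ℂ, Int.cast_prod] at h2
  simp only [Int.cast_natCast] at h2
  rw [← Nat.cast_prod] at h2
  exact eq_smul_of_smul_eq_smul_smul₃₅ hD h2

include eT hX0 hcX hgT hN hgg₀ hXX0 hlr₀ hXXg hCC hC hl hl' hq hK₁ h3₁ h3₁' hK₂ h3₂ h3₂' hqm hps hcd hθ ht hΛ' in
/-- **… and covariantly: `((Λ′)_*(x) : form) = D′ · Λ_ω(x)`** for every `x ∈ Hdgᵖ(X, ℤ)` (g35-#1 `(d₁⋯d_g) · Λ′ = D′ · Π` with §4: `Π` is symmetric, so `Λ′` acts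
alike from both sides although `Λ′` itself need not be symmetric a priori — it is, being a rational multiple of `Π` in the torsion-free group `Hdg^{g−1}(X × X, ℤ)`).
[cite: Bourbaki2008LieGroups79, Ch. VIII §11 no. 1 Lemma 1 (p0203 L3–L5)] [cite: Fulton1998, §16.1 Def. 16.1.2 (p0295 L13–L17)] [cite: Milne1999LefschetzClasses, §5 Thm. 5.9 (p0026 L74–L75)] -/
theorem coe_integralHodgeClassesPushforward_sndHom_cup_pullbackHom_fstHom_eq_smul_lefschetzDual_of_sub_eq_zsmul_kunnethGrading
    (x : integralHodgeClasses X.toIsog.Φ p) :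
    ((integralHodgeClassesPushforward s t (sndHom X X) eXX eX hm hgXX hm' hgX
        (integralHodgeClassesCup (prodObj X X).toIsog.Φ hs Λ' (integralHodgeClassesPullbackHom (fstHom X X) p x)) : integralHodgeClasses X.toIsog.Φ t) :
          X.toIsog.E [⋀^Fin (2 * t)]→L[ℝ] ℂ) =
      (D' : ℂ) • lefschetzDual (-(θ : X.toIsog.E [⋀^Fin 2]→L[ℝ] ℝ)) (2 * t)
        (((x : integralHodgeClasses X.toIsog.Φ p) : X.toIsog.E [⋀^Fin (2 * p)]→L[ℝ] ℂ).domDomCongr (finCongr hp)) := by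
  have hD : ((∏ i, tt i : ℕ) : ℂ) ≠ 0 := Nat.cast_ne_zero.2 (Finset.prod_ne_zero_iff.2 fun i _ ↦ (ht.pos hθ i).ne')
  have h1 := zsmul_eq_zsmul_pontryaginCorrespondence_nsDivPower_of_isPolarizationType X eX eXX eT hX0 hgX hcX hgXX hgT hN hgg₀ hXX0 hlr₀ hXXg hCC hC hl hl'
    hq hK₁ h3₁ h3₁' (Nat.add_comm 1 n) rfl hK₂ h3₂ h3₂' hqm hθ ht Λ' D' hΛ'
  have h2 := congrArg (fun β : integralHodgeClasses (prodObj X X).toIsog.Φ n ↦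
    ((integralHodgeClassesPushforward s t (sndHom X X) eXX eX hm hgXX hm' hgX
        (integralHodgeClassesCup (prodObj X X).toIsog.Φ hs β (integralHodgeClassesPullbackHom (fstHom X X) p x)) : integralHodgeClasses X.toIsog.Φ t) :
          X.toIsog.E [⋀^Fin (2 * t)]→L[ℝ] ℂ)) h1
  dsimp only at h2
  rw [integralHodgeClassesCup_zsmul_left, integralHodgeClassesCup_zsmul_left, map_zsmul, map_zsmul, AddSubgroupClass.coe_zsmul,
    AddSubgroupClass.coe_zsmul] at h2
  rw [coe_integralHodgeClassesPushforward_sndHom_pontryaginCorrespondence_nsDivPower_cup_pullbackHom_fstHom_eq_smul_lefschetzDual X eX eXX hgX hcX hgXX hq hs hps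
      hm hm' hcd hp hθ ht x, ← Int.cast_smul_eq_zsmul ℂ, ← Int.cast_smul_eq_zsmul ℂ, Int.cast_prod] at h2
  simp only [Int.cast_natCast] at h2
  rw [← Nat.cast_prod] at h2
  exact eq_smul_of_smul_eq_smul_smul₃₅ hD h2

include eT hX0 hcX hgT hN hgg₀ hXX0 hlr₀ hXXg hCC hC hq hK₁ h3₁ h3₁' hK₂ h3₂ h3₂' hqm hcd hθ ht in
/-- **An integral correspondence `Λ′` of degree `−1` with `Δ_*[Θ] ∘ Λ′ − Λ′ ∘ Δ_*[Θ] = H_X` EXACTLY induces Hodge theory's `Λ_{c₁(L)}` on the nose**: `(Λ′^*(y) : form)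
= Λ_ω(y)` for every `y ∈ Hdgᵖ(X, ℤ)`, whatever the type `(d₁, …, d_g)` of the polarization (`D′ = 1` in the previous theorem) — so whenever Künnemann's relation
is solvable INTEGRALLY, `Λ_ω` preserves `Hdg•(X, ℤ)`. [cite: Bourbaki2008LieGroups79, Ch. VIII §11 no. 1 Lemma 1 (p0203 L3–L5)] [cite: Moonen2011ChowMotiveAbelianSchemes, §5 (p0015 L2–L5)]
[cite: Milne1999LefschetzClasses, §5 Thm. 5.9 (p0026 L74–L75)] -/
theorem coe_integralHodgeClassesPushforward_fstHom_cup_pullbackHom_sndHom_eq_lefschetzDual_of_sub_eq_kunnethGrading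
    (hΛ'₁ : integralHodgeClassesPushforward K₂ (n + 1) (liftHom (fstHom X (prodObj X X)) (sndHom X (prodObj X X) ≫ sndHom X X)) eT eXX h3₂ hgT h3₂' hgXX
        (integralHodgeClassesCup (prodObj X (prodObj X X)).toIsog.Φ hK₂
          (integralHodgeClassesPullbackHom (liftHom (fstHom X (prodObj X X)) (sndHom X (prodObj X X) ≫ fstHom X X)) n Λ')
          (integralHodgeClassesPullbackHom (sndHom X (prodObj X X)) c₁
            (integralHodgeClassesPushforward 1 c₁ (diagHom X) eX eXX hl hgX hl' hgXX (neronSeveriGroupEquiv X.toIsog.Φ (-θ))))) -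
      integralHodgeClassesPushforward K₁ (n + 1) (liftHom (fstHom X (prodObj X X)) (sndHom X (prodObj X X) ≫ sndHom X X)) eT eXX h3₁ hgT h3₁' hgXX
        (integralHodgeClassesCup (prodObj X (prodObj X X)).toIsog.Φ hK₁
          (integralHodgeClassesPullbackHom (liftHom (fstHom X (prodObj X X)) (sndHom X (prodObj X X) ≫ fstHom X X)) c₁
            (integralHodgeClassesPushforward 1 c₁ (diagHom X) eX eXX hl hgX hl' hgXX (neronSeveriGroupEquiv X.toIsog.Φ (-θ))))
          (integralHodgeClassesPullbackHom (sndHom X (prodObj X X)) n Λ')) =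
      kunnethGrading X eX eXX hX0 hgX hcX hgXX)
    (y : integralHodgeClasses X.toIsog.Φ p) :
    ((integralHodgeClassesPushforward s t (fstHom X X) eXX eX hm hgXX hm' hgX
        (integralHodgeClassesCup (prodObj X X).toIsog.Φ hs Λ' (integralHodgeClassesPullbackHom (sndHom X X) p y)) : integralHodgeClasses X.toIsog.Φ t) :
          X.toIsog.E [⋀^Fin (2 * t)]→L[ℝ] ℂ) =
      lefschetzDual (-(θ : X.toIsog.E [⋀^Fin 2]→L[ℝ] ℝ)) (2 * t)
        (((y : integralHodgeClasses X.toIsog.Φ p) : X.toIsog.E [⋀^Fin (2 * p)]→L[ℝ] ℂ).domDomCongr (finCongr hp)) := by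
  rw [coe_integralHodgeClassesPushforward_fstHom_cup_pullbackHom_sndHom_eq_smul_lefschetzDual_of_sub_eq_zsmul_kunnethGrading X eX eXX eT hX0 hgX hcX hgXX hgT hN
      hgg₀ hXX0 hlr₀ hXXg hCC hC hl hl' hq hK₁ h3₁ h3₁' hK₂ h3₂ h3₂' hqm hs hm hm' hcd hp hθ ht Λ' 1 (by rw [hΛ'₁, one_smul]) y, Int.cast_one, one_smul]

end Uniqueness

end ComplexTorusCat

end Literature.AlgebraicGeometry.HodgeTheory
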